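import Summits.BirchSwinnertonDyer.BirchSwinnertonDyer.Theorems.ByReductionTypeAtTwoFineSelmerConjAAtTwoAdditivePotGoodCapitulationDoor
import HarnessLib

/-!
# Route `ByReductionTypeAtTwo` (rung K4), crux C1″ `FineSelmerConjAAtTwoAdditivePotGood` (item stmt-BirchSwinnertonDyer-22615):
# IDEAL ALGEBRA FOR THE CAPITULATION CERTIFICATES — `(n, β, s − t)·(n, β, s + t) = (n, β)` by Bezout in any ring with `s² = 2`, the
# Galois action on such ideals of `𝓞 K(√2)`, and the relative norm `N_{L/K}(n, β, s − t) = (n, β)`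
# (a `--supports 22615` toolkit file; seat `bsd-2adic-k4-w1` GEN 7; consumer of `…CapitulationDoor` (p706944); consumed by
# `…CapitulationCertificate` and the per-row certificate files)

HONEST FRAMING (cell `bsd-2adic`, D-0036/D-0054): UNCONDITIONAL kernel lemmas; closes nothing; nothing booked; BSD is not proved by any of
this.

THE MECHANISM. `K` a number field, `L/K` quadratic with `s ∈ 𝓞 L`, `s² = 2`, `σ s = −s`. For `n ∈ ℕ` odd, `β ∈ 𝓞 K`, `t ∈ ℤ` with
`t² − 2 = n w`, `(n, w) = (2t, n) = 1`, the ideal `I = (n, β, s − t)` of `𝓞 L` satisfies `I · σI = (n, β) 𝓞 L` — pure commutative algebra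
(`span_triple_mul_span_triple_eq_span_pair`), hence `N_{L/K} I = (n, β)` (`relNorm_eq_of_mul_map_eq`: `N(I)² = N((n, β)𝓞 L) = (n, β)²` and
square roots of ideals are unique) and `N_{L/K}[I] = [(n, β)]` (`classGroupNorm_mk0_eq_of_mul_map_eq`). Every `τ ∈ Gal(L/K)` has
`τ s = ± s`, so `τ I ∈ {I, (n, β, s + t)}` (`map_intAut_span_triple_eq_or`). Also: `(ℓ₁, b − r₁)(ℓ₂, b − r₂) = (ℓ₁ℓ₂, b − r)` by CRT
(`span_pair_mul_span_pair`) and the six-membership criterion for `(y) J₁ = (g) J₀` (`span_singleton_mul_span_triple_eq`).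

References: [Marcus1977] Ch. 3 (splitting of primes in extensions); [Cohen1993] §4.8.2; [Cohen2000] §2.3 (relative norms of ideals);
[Gras2003] II.6.2 (ambiguous ideals and classes).
-/

set_option autoImplicit false
-- sibling precedent (`…CapitulationDoorLayerOne.lean`): the directory name repeats the summit name
set_option linter.dupNamespace false

noncomputable section

open scoped Classical NumberField nonZeroDivisors

namespace Summit.BirchSwinnertonDyer.BirchSwinnertonDyer.Theorems.AddKatoTwo

open NumberField IsDedekindDomain UniqueFactorizationMonoid Polynomial
open Literature.NumberTheory.NumberFields Literature.NumberTheory.NumberFields.AmbiguousClass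
  Literature.NumberTheory.GaloisRepresentations Literature.NumberTheory.IwasawaTheory Literature.NumberTheory.EllipticCurves

/-! ## §1 Commutative algebra: the two ideal identities -/

section Algebra

variable {R : Type} [CommRing R]

/-- `t = u x + v y + w z ⟹ t ∈ (x, y, z)`. [folklore] -/
theorem mem_span_triple_of_eq {x y z t : R} (u v w : R) (h : t = u * x + v * y + w * z) : t ∈ Ideal.span ({x, y, z} : Set R) := by
  rw [h]
  refine Ideal.add_mem _ (Ideal.add_mem _ (Ideal.mul_mem_left _ _ (Ideal.subset_span (by simp)))
    (Ideal.mul_mem_left _ _ (Ideal.subset_span (by simp)))) (Ideal.mul_mem_left _ _ (Ideal.subset_span (by simp)))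

/-- `(x, y, −z) = (x, y, z)`. [folklore] -/
theorem span_triple_neg_last (x y z : R) : Ideal.span ({x, y, -z} : Set R) = Ideal.span ({x, y, z} : Set R) := by
  apply le_antisymm <;> rw [Ideal.span_le] <;> intro a ha <;>
    simp only [Set.mem_insert_iff, Set.mem_singleton_iff] at ha <;> rcases ha with rfl | rfl | rfl
  · exact Ideal.subset_span (by simp)
  · exact Ideal.subset_span (by simp)
  · exact neg_mem (Ideal.subset_span (by simp))
  · exact Ideal.subset_span (by simp)
  · exact Ideal.subset_span (by simp)
  · rw [← neg_neg a]; exact neg_mem (Ideal.subset_span (by simp))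

/-- **`(y)(a', b', c') ⊆ (g)(a, b, c)` from three memberships** `y a' , y b', y c' ∈ g · (a, b, c)` with explicit coefficients. [folklore] -/
theorem span_singleton_mul_span_triple_le {y g a b c a' b' c' : R}
    (h1 : ∃ u v w : R, y * a' = g * (u * a + v * b + w * c)) (h2 : ∃ u v w : R, y * b' = g * (u * a + v * b + w * c))
    (h3 : ∃ u v w : R, y * c' = g * (u * a + v * b + w * c)) :
    Ideal.span {y} * Ideal.span ({a', b', c'} : Set R) ≤ Ideal.span {g} * Ideal.span ({a, b, c} : Set R) := by
  rw [Ideal.span_singleton_mul_le_iff]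
  intro z hz
  refine Submodule.span_induction ?_ ?_ ?_ ?_ hz
  · intro x hx
    simp only [Set.mem_insert_iff, Set.mem_singleton_iff] at hx
    rcases hx with rfl | rfl | rfl
    · obtain ⟨u, v, w, h⟩ := h1
      rw [h]; exact Ideal.mul_mem_mul (Ideal.mem_span_singleton_self g) (mem_span_triple_of_eq u v w rfl)
    · obtain ⟨u, v, w, h⟩ := h2
      rw [h]; exact Ideal.mul_mem_mul (Ideal.mem_span_singleton_self g) (mem_span_triple_of_eq u v w rfl)
    · obtain ⟨u, v, w, h⟩ := h3
      rw [h]; exact Ideal.mul_mem_mul (Ideal.mem_span_singleton_self g) (mem_span_triple_of_eq u v w rfl)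
  · rw [mul_zero]; exact Ideal.zero_mem _
  · intro x₁ x₂ _ _ hx₁ hx₂; rw [mul_add]; exact Ideal.add_mem _ hx₁ hx₂
  · intro r x _ hx; rw [smul_eq_mul, mul_left_comm]; exact Ideal.mul_mem_left _ r hx

/-- **`(y)(a', b', c') = (g)(a, b, c)` from six memberships** (three in each direction), each given by explicit coefficients.
[folklore] -/
theorem span_singleton_mul_span_triple_eq {y g a b c a' b' c' : R}
    (h1 : ∃ u v w : R, y * a' = g * (u * a + v * b + w * c)) (h2 : ∃ u v w : R, y * b' = g * (u * a + v * b + w * c))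
    (h3 : ∃ u v w : R, y * c' = g * (u * a + v * b + w * c)) (h4 : ∃ u v w : R, g * a = y * (u * a' + v * b' + w * c'))
    (h5 : ∃ u v w : R, g * b = y * (u * a' + v * b' + w * c')) (h6 : ∃ u v w : R, g * c = y * (u * a' + v * b' + w * c')) :
    Ideal.span {y} * Ideal.span ({a', b', c'} : Set R) = Ideal.span {g} * Ideal.span ({a, b, c} : Set R) :=
  le_antisymm (span_singleton_mul_span_triple_le h1 h2 h3) (span_singleton_mul_span_triple_le h4 h5 h6)

/-- **`(n, β, s − t) · (n, β, s + t) = (n, β)`** in any commutative ring with `s² = 2`, for `t² − 2 = n w`, `u n + v w = 1`, `a · 2t + c n = 1`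
(so `n w = −(s − t)(s + t)`, `n = u n² + v · n w`, `β = a · (β(s + t) − β(s − t)) + c · nβ`). This is `I · σI = 𝔞 𝓞 L` for the ideal `I` of a
prime of `L = K(√2)` above the degree-one ideal `𝔞 = (n, β)` of `K`. [cite: Marcus1977, Ch. 3 Thm. 25 (splitting in quadratic extensions)] -/
theorem span_triple_mul_span_triple_eq_span_pair (n : ℕ) (β s : R) (t w u v a c : ℤ) (hs : s ^ 2 = 2)
    (htw : t ^ 2 - 2 = n * w) (huv : u * n + v * w = 1) (hac : a * (2 * t) + c * n = 1) :
    Ideal.span ({(n : R), β, s - (t : R)} : Set R) * Ideal.span ({(n : R), β, s + (t : R)} : Set R) = Ideal.span ({(n : R), β} : Set R) := by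
  have htw' : ((t : R)) ^ 2 - 2 = (n : R) * (w : R) := by exact_mod_cast congrArg (Int.cast (R := R)) htw
  have huv' : (u : R) * (n : R) + (v : R) * (w : R) = 1 := by exact_mod_cast congrArg (Int.cast (R := R)) huv
  have hac' : (a : R) * (2 * (t : R)) + (c : R) * (n : R) = 1 := by exact_mod_cast congrArg (Int.cast (R := R)) hac
  apply le_antisymm
  · -- products of generators lie in `(n, β)`
    rw [Ideal.span_mul_span, Ideal.span_le]
    rintro z ⟨x, hx, x', hx', rfl⟩
    dsimp only
    simp only [Set.mem_insert_iff, Set.mem_singleton_iff] at hx hx'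
    have hn : (n : R) ∈ Ideal.span ({(n : R), β} : Set R) := Ideal.subset_span (by simp)
    have hβ : β ∈ Ideal.span ({(n : R), β} : Set R) := Ideal.subset_span (by simp)
    rcases hx with rfl | rfl | rfl
    · exact Ideal.mul_mem_right _ _ hn
    · exact Ideal.mul_mem_right _ _ hβ
    · rcases hx' with rfl | rfl | rfl
      · exact Ideal.mul_mem_left _ _ hn
      · exact Ideal.mul_mem_left _ _ hβ
      · have : (s - (t : R)) * (s + (t : R)) = (-(w : R)) * (n : R) := by linear_combination hs - htw'
        rw [this]; exact Ideal.mul_mem_left _ _ hn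
  · rw [Ideal.span_le]
    intro z hz
    simp only [Set.mem_insert_iff, Set.mem_singleton_iff] at hz
    have hmem : ∀ x ∈ ({(n : R), β, s - (t : R)} : Set R), ∀ x' ∈ ({(n : R), β, s + (t : R)} : Set R),
        x * x' ∈ Ideal.span ({(n : R), β, s - (t : R)} : Set R) * Ideal.span ({(n : R), β, s + (t : R)} : Set R) :=
      fun x hx x' hx' => Ideal.mul_mem_mul (Ideal.subset_span hx) (Ideal.subset_span hx')
    have h_nn := hmem (n : R) (by simp) (n : R) (by simp)
    have h_ss := hmem (s - (t : R)) (by simp) (s + (t : R)) (by simp)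
    have h_bn := hmem β (by simp) (n : R) (by simp)
    have h_bs := hmem β (by simp) (s + (t : R)) (by simp)
    have h_sb := hmem (s - (t : R)) (by simp) β (by simp)
    rcases hz with rfl | rfl
    · -- `n = u n² + v n w = u n² − v (s − t)(s + t)`
      have : (n : R) = (u : R) * ((n : R) * (n : R)) + (-(v : R)) * ((s - (t : R)) * (s + (t : R))) := by
        linear_combination (-(n : R)) * huv' + (v : R) * hs - (v : R) * htw'
      have key := Ideal.add_mem _ (Ideal.mul_mem_left _ (u : R) h_nn) (Ideal.mul_mem_left _ (-(v : R)) h_ss)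
      rwa [← this] at key
    · -- `β = a (β (s + t) − (s − t) β) + c (β n)`
      have : z = (a : R) * (z * (s + (t : R))) + (-(a : R)) * ((s - (t : R)) * z) + (c : R) * (z * (n : R)) := by
        linear_combination (-z) * hac'
      have key := Ideal.add_mem _ (Ideal.add_mem _ (Ideal.mul_mem_left _ (a : R) h_bs) (Ideal.mul_mem_left _ (-(a : R)) h_sb))
        (Ideal.mul_mem_left _ (c : R) h_bn)
      rwa [← this] at key

/-- **`(ℓ₁, b − r₁)(ℓ₂, b − r₂) = (ℓ₁ℓ₂, b − r)`** for coprime `ℓ₁, ℓ₂` (`x ℓ₁ + y ℓ₂ = 1`) and `r ≡ rᵢ (mod ℓᵢ)` (`r − r₁ = ℓ₁ k₁`,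
`r − r₂ = ℓ₂ k₂`): the product of two degree-one ideals above distinct primes, by Chinese remaindering. [cite: Cohen1993, §4.8.2] -/
theorem span_pair_mul_span_pair (b : R) (ℓ₁ ℓ₂ r₁ r₂ r : ℕ) (x y k₁ k₂ : ℤ) (hxy : x * ℓ₁ + y * ℓ₂ = 1)
    (hk₁ : (r : ℤ) - r₁ = ℓ₁ * k₁) (hk₂ : (r : ℤ) - r₂ = ℓ₂ * k₂) :
    Ideal.span ({(ℓ₁ : R), b - (r₁ : R)} : Set R) * Ideal.span ({(ℓ₂ : R), b - (r₂ : R)} : Set R) =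
      Ideal.span ({((ℓ₁ * ℓ₂ : ℕ) : R), b - (r : R)} : Set R) := by
  have hxy' : (x : R) * (ℓ₁ : R) + (y : R) * (ℓ₂ : R) = 1 := by exact_mod_cast congrArg (Int.cast (R := R)) hxy
  have hk₁' : (r : R) - (r₁ : R) = (ℓ₁ : R) * (k₁ : R) := by exact_mod_cast congrArg (Int.cast (R := R)) hk₁
  have hk₂' : (r : R) - (r₂ : R) = (ℓ₂ : R) * (k₂ : R) := by exact_mod_cast congrArg (Int.cast (R := R)) hk₂
  have hn : ((ℓ₁ * ℓ₂ : ℕ) : R) ∈ Ideal.span ({((ℓ₁ * ℓ₂ : ℕ) : R), b - (r : R)} : Set R) := Ideal.subset_span (by simp)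
  have hb : b - (r : R) ∈ Ideal.span ({((ℓ₁ * ℓ₂ : ℕ) : R), b - (r : R)} : Set R) := Ideal.subset_span (by simp)
  apply le_antisymm
  · rw [Ideal.span_mul_span, Ideal.span_le]
    rintro z ⟨c, hc, c', hc', rfl⟩
    dsimp only
    simp only [Set.mem_insert_iff, Set.mem_singleton_iff] at hc hc'
    rcases hc with rfl | rfl <;> rcases hc' with rfl | rfl
    · have : (ℓ₁ : R) * (ℓ₂ : R) = 1 * ((ℓ₁ * ℓ₂ : ℕ) : R) := by push_cast; ring
      rw [this]; exact Ideal.mul_mem_left _ _ hn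
    · have : (ℓ₁ : R) * (b - (r₂ : R)) = (ℓ₁ : R) * (b - (r : R)) + (k₂ : R) * ((ℓ₁ * ℓ₂ : ℕ) : R) := by
        push_cast; linear_combination (ℓ₁ : R) * hk₂'
      rw [this]; exact Ideal.add_mem _ (Ideal.mul_mem_left _ _ hb) (Ideal.mul_mem_left _ _ hn)
    · have : (b - (r₁ : R)) * (ℓ₂ : R) = (ℓ₂ : R) * (b - (r : R)) + (k₁ : R) * ((ℓ₁ * ℓ₂ : ℕ) : R) := by
        push_cast; linear_combination (ℓ₂ : R) * hk₁'
      rw [this]; exact Ideal.add_mem _ (Ideal.mul_mem_left _ _ hb) (Ideal.mul_mem_left _ _ hn)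
    · have : (b - (r₁ : R)) * (b - (r₂ : R)) =
          (b - (r : R) + ((r : R) - r₁) + ((r : R) - r₂)) * (b - (r : R)) + (k₁ * k₂ : R) * ((ℓ₁ * ℓ₂ : ℕ) : R) := by
        push_cast; linear_combination ((r : R) - (r₂ : R)) * hk₁' + ((ℓ₁ : R) * (k₁ : R)) * hk₂'
      rw [this]; exact Ideal.add_mem _ (Ideal.mul_mem_left _ _ hb) (Ideal.mul_mem_left _ _ hn)
  · rw [Ideal.span_le]
    intro z hz
    simp only [Set.mem_insert_iff, Set.mem_singleton_iff] at hz
    have hmem : ∀ c ∈ ({(ℓ₁ : R), b - (r₁ : R)} : Set R), ∀ c' ∈ ({(ℓ₂ : R), b - (r₂ : R)} : Set R),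
        c * c' ∈ Ideal.span ({(ℓ₁ : R), b - (r₁ : R)} : Set R) * Ideal.span ({(ℓ₂ : R), b - (r₂ : R)} : Set R) :=
      fun c hc c' hc' => Ideal.mul_mem_mul (Ideal.subset_span hc) (Ideal.subset_span hc')
    have h11 := hmem (ℓ₁ : R) (by simp) (ℓ₂ : R) (by simp)
    have h12 := hmem (ℓ₁ : R) (by simp) (b - (r₂ : R)) (by simp)
    have h21 := hmem (b - (r₁ : R)) (by simp) (ℓ₂ : R) (by simp)
    rcases hz with rfl | rfl
    · have : ((ℓ₁ * ℓ₂ : ℕ) : R) = 1 * ((ℓ₁ : R) * (ℓ₂ : R)) := by push_cast; ring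
      rw [this]; exact Ideal.mul_mem_left _ _ h11
    · have : b - (r : R) = (x : R) * ((ℓ₁ : R) * (b - (r₂ : R))) + (y : R) * ((b - (r₁ : R)) * (ℓ₂ : R)) +
          (-(x * k₂ + y * k₁ : R)) * ((ℓ₁ : R) * (ℓ₂ : R)) := by
        linear_combination (-(b - (r : R))) * hxy' - (x : R) * (ℓ₁ : R) * hk₂' - (y : R) * (ℓ₂ : R) * hk₁'
      rw [this]
      exact Ideal.add_mem _ (Ideal.add_mem _ (Ideal.mul_mem_left _ _ h12) (Ideal.mul_mem_left _ _ h21)) (Ideal.mul_mem_left _ _ h11)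

/-- **Square roots of ideals are unique** in a Dedekind domain: `I² = J² ⟹ I = J` (unique factorisation). [folklore] -/
theorem eq_of_sq_eq_sq {A : Type} [CommRing A] [IsDedekindDomain A] {I J : Ideal A} (h : I ^ 2 = J ^ 2) : I = J := by
  by_cases hI : I = ⊥
  · subst hI
    rw [← Ideal.zero_eq_bot, zero_pow two_ne_zero, eq_comm, pow_eq_zero_iff two_ne_zero] at h
    rw [← Ideal.zero_eq_bot, h]
  by_cases hJ : J = ⊥
  · subst hJ
    rw [← Ideal.zero_eq_bot, zero_pow two_ne_zero, pow_eq_zero_iff two_ne_zero] at h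
    exact absurd (h.trans Ideal.zero_eq_bot) hI
  have hf : normalizedFactors I = normalizedFactors J := by
    have := congrArg normalizedFactors h
    rw [normalizedFactors_pow, normalizedFactors_pow] at this
    ext x
    have hc := congrArg (Multiset.count x) this
    simp only [Multiset.count_nsmul] at hc
    omega
  exact associated_iff_eq.mp ((associated_iff_normalizedFactors_eq_normalizedFactors hI hJ).mpr hf)

end Algebra

/-! ## §2 The Galois action on `𝓞 L` and on three-generated ideals -/

section Galois

variable {K L : Type} [Field K] [NumberField K] [Field L] [NumberField L] [Algebra K L]

omit [NumberField K] [NumberField L] in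
/-- `intAut τ` fixes `𝓞 K`. [folklore] -/
theorem intAut_algebraMap (τ : L ≃ₐ[K] L) (x : 𝓞 K) :
    intAut τ (algebraMap (𝓞 K) (𝓞 L) x) = algebraMap (𝓞 K) (𝓞 L) x := by
  apply Subtype.ext
  change τ (algebraMap (𝓞 K) (𝓞 L) x : L) = (algebraMap (𝓞 K) (𝓞 L) x : L)
  exact τ.commutes (x : K)

omit [NumberField K] [NumberField L] in
/-- `τ (x, y, z) = (τ x, τ y, τ z)`. [folklore] -/
theorem map_intAut_span_triple (τ : L ≃ₐ[K] L) (x y z : 𝓞 L) :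
    (Ideal.span ({x, y, z} : Set (𝓞 L))).map (intAut τ : 𝓞 L →+* 𝓞 L) = Ideal.span ({intAut τ x, intAut τ y, intAut τ z} : Set (𝓞 L)) := by
  rw [Ideal.map_span, Set.image_insert_eq, Set.image_insert_eq, Set.image_singleton]
  rfl

omit [NumberField K] [NumberField L] in
/-- A square root of `2` in `𝓞 L` is moved by `τ ∈ Gal(L/K)` to `± itself`. [folklore] -/
theorem intAut_eq_self_or_neg_of_sq_eq_two (τ : L ≃ₐ[K] L) {s : 𝓞 L} (hs : s ^ 2 = 2) : intAut τ s = s ∨ intAut τ s = -s := by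
  have h : (intAut τ s) ^ 2 = s ^ 2 := by rw [← map_pow, hs, map_ofNat]
  exact sq_eq_sq_iff_eq_or_eq_neg.mp h

/-- **There is `σ ∈ Gal(L/K)` with `σ s = −s`** when `[L:K] = 2`, `L/K` Galois, `s² = 2` and `2` is not a square in `K`
(`{1, s}` is a `K`-basis; the non-trivial automorphism cannot fix `s`). [folklore] -/
theorem exists_intAut_eq_neg [IsGalois K L] (hdeg : Module.finrank K L = 2) (hK2 : ∀ c : K, c ^ 2 ≠ 2) {s : 𝓞 L}
    (hs : s ^ 2 = 2) : ∃ σ : L ≃ₐ[K] L, intAut σ s = -s := by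
  haveI : FiniteDimensional K L := Module.Finite.of_restrictScalars_finite ℚ K L
  have hs2 : (s : L) ^ 2 = 2 := by
    have := congrArg (algebraMap (𝓞 L) L) hs
    rw [map_pow, map_ofNat] at this
    exact this
  have hsK : ∀ c : K, algebraMap K L c ≠ (s : L) := by
    intro c hc
    apply hK2 c
    apply (algebraMap K L).injective
    rw [map_pow, hc, hs2, map_ofNat]
  have hli : LinearIndependent K ![(1 : L), (s : L)] := by
    refine LinearIndependent.pair_iff.mpr fun a b hab => ?_
    by_cases hb : b = 0
    · subst hb
      simp only [zero_smul, add_zero, smul_eq_zero, one_ne_zero, or_false] at hab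
      exact ⟨hab, rfl⟩
    · exfalso
      apply hsK (-(a / b))
      rw [Algebra.smul_def, Algebra.smul_def, mul_one] at hab
      have hb' : algebraMap K L b ≠ 0 := by rwa [Ne, map_eq_zero]
      rw [map_neg, map_div₀, ← neg_div, div_eq_iff hb']
      linear_combination (-1 : L) * hab
  have hspan : ∀ x : L, ∃ a b : K, x = algebraMap K L a + algebraMap K L b * (s : L) := by
    intro x
    let B : Module.Basis (Fin 2) K L := basisOfLinearIndependentOfCardEqFinrank hli (by simp [hdeg])
    have hB : ∀ i, B i = ![(1 : L), (s : L)] i := fun i => by simp [B, coe_basisOfLinearIndependentOfCardEqFinrank]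
    refine ⟨B.repr x 0, B.repr x 1, ?_⟩
    conv_lhs => rw [← B.sum_repr x]
    rw [Fin.sum_univ_two, hB, hB, Algebra.smul_def, Algebra.smul_def]
    simp
  have hcard : Nat.card (L ≃ₐ[K] L) = 2 := by rw [IsGalois.card_aut_eq_finrank, hdeg]
  obtain ⟨σ, hσ1⟩ : ∃ σ : L ≃ₐ[K] L, σ ≠ 1 := by
    by_contra h
    have h' : ∀ σ : L ≃ₐ[K] L, σ = 1 := fun σ => not_not.mp (not_exists.mp h σ)
    have : Nat.card (L ≃ₐ[K] L) = 1 := Nat.card_eq_one_iff_exists.mpr ⟨1, h'⟩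
    omega
  refine ⟨σ, ?_⟩
  rcases intAut_eq_self_or_neg_of_sq_eq_two σ hs with h0 | h0
  · exfalso
    apply hσ1
    have hfix : σ (s : L) = (s : L) := congrArg (fun x : 𝓞 L => (x : L)) h0
    ext x
    obtain ⟨a, b, rfl⟩ := hspan x
    rw [map_add, map_mul, AlgEquiv.commutes, AlgEquiv.commutes, hfix, AlgEquiv.one_apply]
  · exact h0

omit [NumberField K] [NumberField L] in
/-- `τ I` for `I = (n, β, s − t)`, `β ∈ 𝓞 K`: either `I` or `(n, β, s + t)`. [folklore] -/
theorem map_intAut_span_triple_eq_or (τ : L ≃ₐ[K] L) {s : 𝓞 L} (hs : s ^ 2 = 2) (n : ℕ) (β : 𝓞 K) (t : ℤ) :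
    (Ideal.span ({(n : 𝓞 L), algebraMap (𝓞 K) (𝓞 L) β, s - (t : 𝓞 L)} : Set (𝓞 L))).map (intAut τ : 𝓞 L →+* 𝓞 L) =
        Ideal.span ({(n : 𝓞 L), algebraMap (𝓞 K) (𝓞 L) β, s - (t : 𝓞 L)} : Set (𝓞 L)) ∨
      (Ideal.span ({(n : 𝓞 L), algebraMap (𝓞 K) (𝓞 L) β, s - (t : 𝓞 L)} : Set (𝓞 L))).map (intAut τ : 𝓞 L →+* 𝓞 L) =
        Ideal.span ({(n : 𝓞 L), algebraMap (𝓞 K) (𝓞 L) β, s + (t : 𝓞 L)} : Set (𝓞 L)) := by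
  rw [map_intAut_span_triple, map_natCast, intAut_algebraMap, map_sub, map_intCast]
  rcases intAut_eq_self_or_neg_of_sq_eq_two τ hs with h | h <;> rw [h]
  · exact Or.inl rfl
  · right
    rw [show -s - (t : 𝓞 L) = -(s + (t : 𝓞 L)) by ring, span_triple_neg_last]

/-! ## §3 The relative norm of `I` from `I · σI = 𝔞 𝓞 L` -/

/-- `[Frac 𝓞_K : … ]`: the degree of the fraction fields of the rings of integers is `[L : K]` (the exponent in Mathlib's
`Ideal.relNorm_algebraMap`; same statement as the tree's `finrank_fractionRing_ringOfIntegers` in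
`Literature/Barriers/HodgeConjecture/ConjugateVarietiesSerreProofs`, reproved here to keep the import cone small). [folklore] -/
theorem finrank_fractionRing_ringOfIntegers_eq_finrank :
    letI := FractionRing.liftAlgebra (𝓞 K) (FractionRing (𝓞 L))
    Module.finrank (FractionRing (𝓞 K)) (FractionRing (𝓞 L)) = Module.finrank K L := by
  letI := FractionRing.liftAlgebra (𝓞 K) (FractionRing (𝓞 L))
  refine Algebra.finrank_eq_of_equiv_equiv (FractionRing.algEquiv (𝓞 K) K).toRingEquiv
    (FractionRing.algEquiv (𝓞 L) L).toRingEquiv ?_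
  ext x
  exact IsFractionRing.algEquiv_commutes (FractionRing.algEquiv (𝓞 K) K) (FractionRing.algEquiv (𝓞 L) L) _

/-- `intAut τ` and Mathlib's `galRestrict` agree, so `Ideal.map` along them agree. [folklore] -/
theorem map_intAut_eq_map_galRestrict (τ : L ≃ₐ[K] L) (I : Ideal (𝓞 L)) :
    I.map (intAut τ : 𝓞 L →+* 𝓞 L) = I.map (galRestrict (𝓞 K) K L (𝓞 L) τ) := by
  have h : ∀ x : 𝓞 L, intAut τ x = galRestrict (𝓞 K) K L (𝓞 L) τ x := by
    intro x
    apply Subtype.ext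
    change τ (x : L) = ((galRestrict (𝓞 K) K L (𝓞 L) τ x : 𝓞 L) : L)
    exact (algebraMap_galRestrict_apply (𝓞 K) τ x).symm
  unfold Ideal.map
  congr 1
  ext y
  constructor <;> rintro ⟨x, hx, rfl⟩ <;> exact ⟨x, hx, by simp [h x]⟩

/-- `N_{L/K}(τ I) = N_{L/K}(I)`. [cite: Cohen2000, §2.3 (Prop. 2.3.1, Galois invariance of the relative norm)] -/
theorem relNorm_map_intAut (τ : L ≃ₐ[K] L) (I : Ideal (𝓞 L)) :
    Ideal.relNorm (𝓞 K) (I.map (intAut τ : 𝓞 L →+* 𝓞 L)) = Ideal.relNorm (𝓞 K) I := by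
  rw [map_intAut_eq_map_galRestrict, Ideal.relNorm_map_algEquiv]

/-- `N_{L/K}(𝔞 𝓞 L) = 𝔞^{[L:K]}`. [cite: Cohen2000, §2.3 (Prop. 2.3.1)] -/
theorem relNorm_map_algebraMap (𝔞 : Ideal (𝓞 K)) :
    Ideal.relNorm (𝓞 K) (𝔞.map (algebraMap (𝓞 K) (𝓞 L))) = 𝔞 ^ Module.finrank K L := by
  rw [Ideal.relNorm_algebraMap, finrank_fractionRing_ringOfIntegers_eq_finrank]

/-- **`I · τI = 𝔞 𝓞 L` with `[L:K] = 2` ⟹ `N_{L/K} I = 𝔞`** (`N(I)² = N(I) N(τ I) = N(𝔞 𝓞 L) = 𝔞²` and `eq_of_sq_eq_sq`).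
[cite: Cohen2000, §2.3 (Prop. 2.3.1)] [cite: Marcus1977, Ch. 3 Thm. 25] -/
theorem relNorm_eq_of_mul_map_eq (hdeg : Module.finrank K L = 2) (τ : L ≃ₐ[K] L) {I : Ideal (𝓞 L)} {𝔞 : Ideal (𝓞 K)}
    (h : I * I.map (intAut τ : 𝓞 L →+* 𝓞 L) = 𝔞.map (algebraMap (𝓞 K) (𝓞 L))) : Ideal.relNorm (𝓞 K) I = 𝔞 := by
  apply eq_of_sq_eq_sq
  rw [sq, ← hdeg, ← relNorm_map_algebraMap, ← h, map_mul, relNorm_map_intAut]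

/-- **`N_{L/K}[I] = [𝔞]`** in the class groups, in the same situation. [cite: Lang1990, Ch. 3 §4 (Lemma to Thm. 4.3)] -/
theorem classGroupNorm_mk0_eq_of_mul_map_eq (hdeg : Module.finrank K L = 2) (τ : L ≃ₐ[K] L) {I : Ideal (𝓞 L)} {𝔞 : Ideal (𝓞 K)}
    (h : I * I.map (intAut τ : 𝓞 L →+* 𝓞 L) = 𝔞.map (algebraMap (𝓞 K) (𝓞 L))) (hI : I ∈ (Ideal (𝓞 L))⁰) (h𝔞 : 𝔞 ∈ (Ideal (𝓞 K))⁰) :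
    classGroupNorm K L (ClassGroup.mk0 ⟨I, hI⟩) = ClassGroup.mk0 ⟨𝔞, h𝔞⟩ := by
  rw [classGroupNorm_mk0]
  congr 1
  apply Subtype.ext
  exact relNorm_eq_of_mul_map_eq hdeg τ h

end Galois

end Summit.BirchSwinnertonDyer.BirchSwinnertonDyer.Theorems.AddKatoTwo

end
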